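import Summits.Langlands.Langlands.Theorems.IrreducibilityBySelfDualityGaloisRepOfRegularAlgebraic
import Summits.Langlands.Langlands.Theorems.IrreducibilityBySelfDualityGaloisRepOfRegularAlgebraicSatakeGap
import Summits.Langlands.Langlands.Theorems.IrreducibilityBySelfDualityGaloisRepOfRegularAlgebraicGapTransport
import Summits.Langlands.Langlands.Theorems.IrreducibilityBySelfDualityGaloisRepOfRegularAlgebraicMonodromyGap
import Summits.Langlands.Langlands.Theorems.IrreducibilityBySelfDualityGaloisRepOfRegularAlgebraicInertiaTraces
import Summits.Langlands.Langlands.Theorems.IrreducibilityBySelfDualityGaloisRepOfRegularAlgebraicLocalRigidity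
import Literature.NumberTheory.Automorphic.HarrisLanTaylorThorneThm713
import HarnessLib

/-!
# `GaloisRepOfRegularAlgebraic` (stmt-Langlands-10785) from HLTT Thm. A and Varma's Thm. 1 alone:
# the composition of line `Sketch`

This file assembles the five landed stubs of the crux line
`Cruxes/GaloisRepOfRegularAlgebraic/Lines/Sketch.lean` (`stub_satakeGap`, `stub_gapTransport`,
`stub_monodromyGap`, `stub_inertiaTraces`, `stub_localRigidity`, all in namespace
`Summit.Langlands.Langlands.Theorems.GaloisRepOfRegularAlgebraic`) into the reduction they were built
for.  Like its sibling `IrreducibilityBySelfDualityGaloisRepOfRegularAlgebraic.lean` it does NOT import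
the Theses file and states the item's text verbatim.

* `isGaloisCompatibleAt_of_weilTraces` — the local engine at ONE place: for any continuous
  `r : Γ_K → GL_n(ℚ̄_ℓ)`, a finite `v ∤ ℓ` and a cuspidal regular algebraic `π` (Borel–Jacquet datum,
  `K` totally real or CM) with Satake parameter `α` at `v`, if every `σ ∈ Γ_{K_v}` of NON-ZERO
  Frobenius degree `d` has `tr r(σ) = ∑_b b^d` over the roots `b` of `arithFrobPolyOfSatake ι q_v n α`,
  then `r` is unramified at `v` with that characteristic polynomial of Frobenius.  (Inertia traces by
  backward Cayley–Hamilton, the Satake gap `a ≠ q_v b` from Jacquet–Shalika's Cor. (2.5), and local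
  rigidity = Grothendieck's monodromy theorem + "generic gap kills monodromy".)
* `corollary93_unramified_of_weilTraces` — hence the tree's Varma leaf
  `Varma2024.corollary93_unramified` (which stands for Varma's Thm. 1 AND Thm. 2 / `≺`) FOLLOWS from
  the trace form of **Theorem 1 alone** at unramified places on non-zero-degree elements
  (hypothesis `hV1`, the text of leaf S2 of the skeleton = the Literature named fact
  `Varma2024.theorem1_unramified_traces` restricted to `d ≠ 0`, proposal p98836).
* `of_theoremA_of_weilTraces` — the item from `theoremA_existence` + `hV1`;
  `of_leaves_of_weilTraces` — the item from HLTT Cor. 6.27, Arthur–Clozel's archimedean clause,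
  strong prime-degree base change `hBC`, and `hV1` (compare `of_leaves`, whose fourth leaf was
  `corollary93_unramified`): Varma's Theorem 2 (§§8–9 of the paper: Schneider–Zink types, the finer
  patching) has left the cone of lang.S27.

References: I. Varma, Forum Math. Sigma 12 (2024) e21, Thm. 1, Cor. 9.3 [VarmaFMS2024];
M. Harris, K.-W. Lan, R. Taylor, J. Thorne, Res. Math. Sci. 3:37 (2016), Thm. A [HarrisLanTaylorThorneRMS2016];
H. Jacquet, J. Shalika, Amer. J. Math. 103 (1981), Cor. (2.5) [JacquetShalikaAJM1981];
J. Tate, Corvallis 1979, §4.2 [TateCorvallis1979].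
-/

noncomputable section

set_option linter.dupNamespace false

open scoped MatrixGroups Matrix NumberField Polynomial
open NumberField IsDedekindDomain Field Polynomial
open Literature.NumberTheory.Automorphic Literature.NumberTheory.GaloisRepresentations
open Literature.NumberTheory.Automorphic.HarrisLanTaylorThorne2016

namespace Summit.Langlands.Langlands.Theorems.GaloisRepOfRegularAlgebraic

/-! ### The local engine at one place -/

/-- **Compatibility at `v` from the Weil traces in non-zero degree.**  Let `K` be totally real or CM,
`π` regular algebraic cuspidal on `GL_n(𝔸_K)` with Satake parameter `α` at the finite place
`v ∤ ℓ`, `ι : ℚ̄_ℓ ≃ ℂ`, and `r : Γ_K → GL_n(ℚ̄_ℓ)` continuous.  If every `σ ∈ Γ_{K_v}` of Frobenius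
degree `d ≠ 0` has `tr r(σ) = ∑_b b ^ d`, `b` running over the roots of `arithFrobPolyOfSatake ι q_v n α`,
then `r` is unramified at `v` and every arithmetic Frobenius at `v` has characteristic polynomial
`arithFrobPolyOfSatake ι q_v n α`.  Assembly of the
landed stubs: `stub_satakeGap` (gap `a ≠ q_v b` on `α`, whence `0 ∉ α`), `stub_gapTransport`,
`stub_inertiaTraces` (degree `0`), `stub_localRigidity` fed with `stub_monodromyGap`, and
`arithFrobPolyOfSatake_eq_prod_roots`. [cite: VarmaFMS2024, Thm. 1] [cite: TateCorvallis1979, §4.2 (4.2.1)] -/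
theorem isUnramifiedAt_and_hasFrobCharpolyAt_of_weilTraces {n : ℕ} {K : Type} [Field K]
    [NumberField K] (hcpt : isCompact_glFiniteIntegralLevel n K) (hK : IsTotallyReal K ∨ IsCMField K)
    (π : CuspidalAutomorphicRepData n K hcpt) (hπ : π.1.IsRegularAlgebraic) {ℓ : ℕ} [Fact ℓ.Prime]
    (ι : PadicAlgCl ℓ ≃+* ℂ) (r : FramedGaloisRep K (PadicAlgCl ℓ) n) (v : HeightOneSpectrum (𝓞 K))
    (hv : ((ℓ : ℕ) : 𝓞 K) ∉ v.asIdeal) (α : Multiset ℂ) (hα : π.1.HasSatakeParamAt v α)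
    (htr : ∀ (σ : absoluteGaloisGroup (v.adicCompletion K)) (d : ℤ), d ≠ 0 → IsFrobPow σ d →
      (((r.toLocal v) σ : GL (Fin n) (PadicAlgCl ℓ)) : Matrix (Fin n) (Fin n) (PadicAlgCl ℓ)).trace
        = ((arithFrobPolyOfSatake ι v.residueCard n α).roots.map fun b => b ^ d).sum) :
    r.IsUnramifiedAt v ∧ r.HasFrobCharpolyAt v (arithFrobPolyOfSatake ι v.residueCard n α) := by
  have hq : 0 < v.residueCard := lt_trans zero_lt_one v.one_lt_residueCard
  have hgapα : ∀ a ∈ α, ∀ b ∈ α, a ≠ (v.residueCard : ℂ) * b := stub_satakeGap hcpt hK π hπ v α hα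
  have hα0 : (0 : ℂ) ∉ α := fun h0 => hgapα 0 h0 0 h0 (by rw [mul_zero])
  set β : Multiset (PadicAlgCl ℓ) := (arithFrobPolyOfSatake ι v.residueCard n α).roots with hβdef
  have hβn : Multiset.card β = n := by
    rw [hβdef, card_roots_arithFrobPolyOfSatake, hα.card_eq]
  have hβ0 : (0 : PadicAlgCl ℓ) ∉ β :=
    zero_not_mem_roots_arithFrobPolyOfSatake ι hq n fun a ha h => hα0 (h ▸ ha)
  have hgapβ : ∀ a ∈ β, ∀ b ∈ β, a ≠ (v.residueCard : PadicAlgCl ℓ) * b :=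
    stub_gapTransport ι v.residueCard n hq α hα0 hgapα
  have htr0 : ∀ (σ : absoluteGaloisGroup (v.adicCompletion K)) (d : ℤ), d ≠ 0 → IsFrobPow σ d →
      (((r.toLocal v).toMonoidHom σ : GL (Fin n) (PadicAlgCl ℓ)) :
          Matrix (Fin n) (Fin n) (PadicAlgCl ℓ)).trace = (β.map fun b => b ^ d).sum :=
    fun σ d hd hσ => htr σ d hd hσ
  have htr' : ∀ (σ : absoluteGaloisGroup (v.adicCompletion K)) (d : ℤ), IsFrobPow σ d →
      (((r.toLocal v) σ : GL (Fin n) (PadicAlgCl ℓ)) : Matrix (Fin n) (Fin n) (PadicAlgCl ℓ)).trace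
        = (β.map fun b => b ^ d).sum :=
    fun σ d hσ => stub_inertiaTraces (r.toLocal v).toMonoidHom β hβn htr0 σ d hσ
  obtain ⟨hunr, hfrob⟩ :=
    stub_localRigidity stub_monodromyGap v hv r β hβn hβ0 htr' hgapβ
  refine ⟨hunr, ?_⟩
  rw [arithFrobPolyOfSatake_eq_prod_roots]
  exact hfrob

/-- The same with conclusion `IsGaloisCompatibleAt π ι r v`, the trace hypothesis being made for every
Satake parameter of `π` at `v`. [cite: VarmaFMS2024, Thm. 1] -/
theorem isGaloisCompatibleAt_of_weilTraces {n : ℕ} {K : Type} [Field K]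
    [NumberField K] (hcpt : isCompact_glFiniteIntegralLevel n K) (hK : IsTotallyReal K ∨ IsCMField K)
    (π : CuspidalAutomorphicRepData n K hcpt) (hπ : π.1.IsRegularAlgebraic) {ℓ : ℕ} [Fact ℓ.Prime]
    (ι : PadicAlgCl ℓ ≃+* ℂ) (r : FramedGaloisRep K (PadicAlgCl ℓ) n) (v : HeightOneSpectrum (𝓞 K))
    (hv : ((ℓ : ℕ) : 𝓞 K) ∉ v.asIdeal)
    (htr : ∀ (α : Multiset ℂ), π.1.HasSatakeParamAt v α →
      ∀ (σ : absoluteGaloisGroup (v.adicCompletion K)) (d : ℤ), d ≠ 0 → IsFrobPow σ d →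
      (((r.toLocal v) σ : GL (Fin n) (PadicAlgCl ℓ)) : Matrix (Fin n) (Fin n) (PadicAlgCl ℓ)).trace
        = ((arithFrobPolyOfSatake ι v.residueCard n α).roots.map fun b => b ^ d).sum) :
    IsGaloisCompatibleAt π.1 ι r v :=
  fun α hα => isUnramifiedAt_and_hasFrobCharpolyAt_of_weilTraces hcpt hK π hπ ι r v hv α hα (htr α hα)

/-! ### The tree's Varma leaf from Theorem 1 alone -/

/-- **`Varma2024.corollary93_unramified` from the trace form of Varma's Theorem 1 at unramified
places (non-zero degree).**  The hypothesis `hV1` is leaf S2 of the skeleton `Lines/Sketch.lean`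
(= the Literature named fact `Varma2024.theorem1_unramified_traces`, p98836, restricted to `d ≠ 0`):
for `K` totally real or CM, `π` regular algebraic cuspidal, `r` semisimple with HLTT's property, `v ∤ ℓ`
with Satake parameter `α`, every `σ ∈ Γ_{K_v}` of degree `d ≠ 0` has `tr r(σ) = ∑_b b ^ d`.
Conclusion: every such `r` is compatible with `π` at every `v ∤ ℓ` — the tree's rendering of Varma's
Cor. 9.3, whose printed proof uses Theorem 2 (`≺`, §§8–9); here Theorem 2 is replaced by the
Satake gap of a cuspidal `π` and Grothendieck's monodromy theorem (`isGaloisCompatibleAt_of_weilTraces`).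
[cite: VarmaFMS2024, Thm. 1 and Cor. 9.3] -/
theorem corollary93_unramified_of_weilTraces :
    (∀ {n : ℕ} {K : Type} [Field K] [NumberField K] (hcpt : isCompact_glFiniteIntegralLevel n K),
      IsTotallyReal K ∨ IsCMField K →
      ∀ (π : CuspidalAutomorphicRepData n K hcpt), π.1.IsRegularAlgebraic →
      ∀ (ℓ : ℕ) [Fact ℓ.Prime] (ι : PadicAlgCl ℓ ≃+* ℂ) (r : FramedGaloisRep K (PadicAlgCl ℓ) n),
        r.toGaloisRep.IsSemisimple → IsCompatible π.1 ι r →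
        ∀ (v : HeightOneSpectrum (𝓞 K)), ((ℓ : ℕ) : 𝓞 K) ∉ v.asIdeal →
        ∀ (α : Multiset ℂ), π.1.HasSatakeParamAt v α →
        ∀ (σ : absoluteGaloisGroup (v.adicCompletion K)) (d : ℤ), d ≠ 0 → IsFrobPow σ d →
          (((r.toLocal v) σ : GL (Fin n) (PadicAlgCl ℓ)) : Matrix (Fin n) (Fin n) (PadicAlgCl ℓ)).trace
            = ((arithFrobPolyOfSatake ι v.residueCard n α).roots.map fun b => b ^ d).sum) →
    Varma2024.corollary93_unramified :=
  fun hV1 _ _ _ _ hcpt hK π hπ ℓ _ ι r hr hc v hv =>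
    isGaloisCompatibleAt_of_weilTraces hcpt hK π hπ ι r v hv
      (fun α hα σ d hd hσ => hV1 hcpt hK π hπ ℓ ι r hr hc v hv α hα σ d hd hσ)

/-! ### The item from Thm. A and Theorem 1 -/

/-- **The item from HLTT's Thm. A (existence) and the trace form of Varma's Theorem 1** (leaves S1
and S2 of the skeleton `Lines/Sketch.lean`; everything else is proved):
`of_fact ∘ exists_galoisRep_of_regularAlgebraic_of hA (corollary93_unramified_of_weilTraces hV1)`.
[cite: HarrisLanTaylorThorneRMS2016, Thm. A (p. 3)] [cite: VarmaFMS2024, Thm. 1] -/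
theorem of_theoremA_of_weilTraces (hA : theoremA_existence)
    (hV1 : ∀ {n : ℕ} {K : Type} [Field K] [NumberField K] (hcpt : isCompact_glFiniteIntegralLevel n K),
      IsTotallyReal K ∨ IsCMField K →
      ∀ (π : CuspidalAutomorphicRepData n K hcpt), π.1.IsRegularAlgebraic →
      ∀ (ℓ : ℕ) [Fact ℓ.Prime] (ι : PadicAlgCl ℓ ≃+* ℂ) (r : FramedGaloisRep K (PadicAlgCl ℓ) n),
        r.toGaloisRep.IsSemisimple → IsCompatible π.1 ι r →
        ∀ (v : HeightOneSpectrum (𝓞 K)), ((ℓ : ℕ) : 𝓞 K) ∉ v.asIdeal →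
        ∀ (α : Multiset ℂ), π.1.HasSatakeParamAt v α →
        ∀ (σ : absoluteGaloisGroup (v.adicCompletion K)) (d : ℤ), d ≠ 0 → IsFrobPow σ d →
          (((r.toLocal v) σ : GL (Fin n) (PadicAlgCl ℓ)) : Matrix (Fin n) (Fin n) (PadicAlgCl ℓ)).trace
            = ((arithFrobPolyOfSatake ι v.residueCard n α).roots.map fun b => b ^ d).sum) :
    ∀ (n : ℕ) (K : Type) [Field K] [NumberField K] (hcpt : isCompact_glFiniteIntegralLevel n K),
      (IsTotallyReal K ∨ IsCMField K) → ∀ (π : CuspidalAutomorphicRepData n K hcpt),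
      π.1.IsRegularAlgebraic → ∀ (ℓ : ℕ) [Fact ℓ.Prime] (ι : PadicAlgCl ℓ ≃+* ℂ),
      ∃ r : FramedGaloisRep K (PadicAlgCl ℓ) n, r.toGaloisRep.IsSemisimple ∧
        ∀ (v : HeightOneSpectrum (𝓞 K)) (α : Multiset ℂ), π.1.HasSatakeParamAt v α →
          ((ℓ : ℕ) : 𝓞 K) ∉ v.asIdeal →
            r.IsUnramifiedAt v ∧ r.HasFrobCharpolyAt v (arithFrobPolyOfSatake ι v.residueCard n α) :=
  of_fact (exists_galoisRep_of_regularAlgebraic_of hA (corollary93_unramified_of_weilTraces hV1))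

/-- **The item from its leaves after line `Sketch`**: HLTT Cor. 6.27 (`corollary627_splitOrUnramified`),
the archimedean clause of Arthur–Clozel's strong lifting (`ArthurClozel1989_strongLifting_archimedean`),
Arthur–Clozel's strong cuspidal base change in prime degree (`hBC`, raw as in `of_leaves`) — these
three give Thm. A by `theoremA_existence_of_leaves'` — and the trace form of Varma's Theorem 1 at
unramified places (`hV1`).  Compare `of_leaves`: its fourth leaf `Varma2024.corollary93_unramified`
(Theorems 1 + 2) is replaced by Theorem 1 alone.
[cite: HarrisLanTaylorThorneRMS2016, Cor. 6.27, Thm. 7.13, Cor. 7.14 (p. 232)] [cite: VarmaFMS2024, Thm. 1] -/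
theorem of_leaves_of_weilTraces (h627 : corollary627_splitOrUnramified)
    (harch : ArthurClozel1989_strongLifting_archimedean)
    (hBC : ∀ (n : ℕ) (F E : Type) [Field F] [NumberField F] [Field E] [NumberField E] [Algebra F E]
      [IsGalois F E], (Module.finrank F E).Prime →
      ∀ (hF : isCompact_glFiniteIntegralLevel n F) (π : CuspidalAutomorphicRepData n F hF),
        (∃ v : HeightOneSpectrum (𝓞 F),
            ¬ Algebra.IsUnramifiedIn (𝓞 E) v.asIdeal ∧ π.1.IsUnramifiedAt v) →
        ∀ (hE : isCompact_glFiniteIntegralLevel n E),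
          ∃ P : CuspidalAutomorphicRepData n E hE,
            ∀ (w : HeightOneSpectrum (𝓞 E)) (v : HeightOneSpectrum (𝓞 F)) (α : Multiset ℂ),
              w.asIdeal.under (𝓞 F) = v.asIdeal → Algebra.IsUnramifiedIn (𝓞 E) v.asIdeal →
                π.1.HasSatakeParamAt v α →
                  P.1.HasSatakeParamAt w (α.map (· ^ w.asIdeal.inertiaDeg (𝓞 F))))
    (hV1 : ∀ {n : ℕ} {K : Type} [Field K] [NumberField K] (hcpt : isCompact_glFiniteIntegralLevel n K),
      IsTotallyReal K ∨ IsCMField K →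
      ∀ (π : CuspidalAutomorphicRepData n K hcpt), π.1.IsRegularAlgebraic →
      ∀ (ℓ : ℕ) [Fact ℓ.Prime] (ι : PadicAlgCl ℓ ≃+* ℂ) (r : FramedGaloisRep K (PadicAlgCl ℓ) n),
        r.toGaloisRep.IsSemisimple → IsCompatible π.1 ι r →
        ∀ (v : HeightOneSpectrum (𝓞 K)), ((ℓ : ℕ) : 𝓞 K) ∉ v.asIdeal →
        ∀ (α : Multiset ℂ), π.1.HasSatakeParamAt v α →
        ∀ (σ : absoluteGaloisGroup (v.adicCompletion K)) (d : ℤ), d ≠ 0 → IsFrobPow σ d →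
          (((r.toLocal v) σ : GL (Fin n) (PadicAlgCl ℓ)) : Matrix (Fin n) (Fin n) (PadicAlgCl ℓ)).trace
            = ((arithFrobPolyOfSatake ι v.residueCard n α).roots.map fun b => b ^ d).sum) :
    ∀ (n : ℕ) (K : Type) [Field K] [NumberField K] (hcpt : isCompact_glFiniteIntegralLevel n K),
      (IsTotallyReal K ∨ IsCMField K) → ∀ (π : CuspidalAutomorphicRepData n K hcpt),
      π.1.IsRegularAlgebraic → ∀ (ℓ : ℕ) [Fact ℓ.Prime] (ι : PadicAlgCl ℓ ≃+* ℂ),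
      ∃ r : FramedGaloisRep K (PadicAlgCl ℓ) n, r.toGaloisRep.IsSemisimple ∧
        ∀ (v : HeightOneSpectrum (𝓞 K)) (α : Multiset ℂ), π.1.HasSatakeParamAt v α →
          ((ℓ : ℕ) : 𝓞 K) ∉ v.asIdeal →
            r.IsUnramifiedAt v ∧ r.HasFrobCharpolyAt v (arithFrobPolyOfSatake ι v.residueCard n α) :=
  of_theoremA_of_weilTraces (theoremA_existence_of_leaves' h627 harch hBC) hV1

end Summit.Langlands.Langlands.Theorems.GaloisRepOfRegularAlgebraic

end
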